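import Summits.NavierStokesRegularity.NavierStokesRegularity.Theorems.FilamentSkeletonRssCoreLinearInvertibilityArnoldModeSplitToolsB
import Literature.Analysis.Potential.CircleLogKernel
import Literature.Analysis.FluidPDE.PlanarLogPotential
import Literature.Analysis.FluidPDE.GaussWeightedBiotSavartBounds
import Summits.AnomalousDissipation.AnomalousDissipation.Theorems.MarginalStabilityChainStretchedVortexRowsStubLogPotentialTools

/-!
# Tools for stub `stub_arnoldModeSplit` (crux `CoreLinearInvertibility`, stmt-NavierStokesRegularity-17973,
# route `FilamentSkeletonRss`, line `Sketch`) — part C: the `k = ±1` circle moments of the logarithmic kernel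

For the planar logarithmic kernel on the circle of radius `r > 0` and a source point `η`, `|η| ≠ r`:

  `∫_{-π}^{π} log |circlePt r θ − η| cos θ dθ = −π t(r, |η|) η₀/|η|`,
  `∫_{-π}^{π} log |circlePt r θ − η| sin θ dθ = −π t(r, |η|) η₁/|η|`,   `t(r, ρ) = min(r,ρ)/max(r,ρ)`

(`modeSplit_integral_log_circle_cos/sin`): indeed `|circlePt r θ − circlePt ρ φ| = max(r,ρ) |1 − t e^{i(θ−φ)}|`,
so `log |circlePt r θ − η| = log max(r,ρ) + ℓ_t(θ − φ)` with the regularised circle kernel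
`ℓ_t(v) = log |1 − t e^{iv}|` of `Literature.Analysis.Potential.CircleLogKernel`, whose first Fourier moments
are `∫ ℓ_t cos = −π t`, `∫ ℓ_t sin = 0` (loc. cit.). This is the mode `k = ±1` case of the multipole
expansion `log|ξ − η| = log max − Σ_{m ≥ 1} tᵐ cos m(θ − φ)/m` behind Gallay–Šverák's per-mode potential
formula (arXiv:2110.13739, §3, (Bkdef)). Also: a bound `∫ |log|x − y|| |f(y)| dy ≤ K(1 + |x|)` for a
Gaussian-bounded continuous `f`, and the integrability on `(−π, π] × ℝ²` of
`(θ, y) ↦ w(θ) N(circlePt r θ − y) f(y)` (Fubini for circle integrals of `ψ_f = N ∗ f`). Folklore.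
-/

set_option linter.dupNamespace false

noncomputable section

namespace Summit.NavierStokesRegularity.NavierStokesRegularity.Theorems

open Set Function Filter MeasureTheory Topology Metric
open Literature.Analysis.FluidPDE Literature.Analysis.Potential
open Summit.AnomalousDissipation.AnomalousDissipation.Theorems.MarginalStabilityChainStretchedVortexRows
open scoped Real

/-! ### The distance between two circle points -/

/-- **`|circlePt r θ − circlePt ρ φ| = max(r,ρ) · |1 − t e^{i(θ−φ)}|`**, `t = min(r,ρ)/max(r,ρ)`
(`r > 0`; both squares equal `r² + ρ² − 2rρ cos(θ − φ)`). [folklore] -/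
theorem modeSplit_norm_circlePt_sub_circlePt {r : ℝ} (hr : 0 < r) (ρ θ φ : ℝ) :
    ‖circlePt r θ - circlePt ρ φ‖ = max r ρ *
      ‖1 - ((min r ρ / max r ρ : ℝ) : ℂ) * Complex.exp (((θ - φ : ℝ) : ℂ) * Complex.I)‖ := by
  have hM : 0 < max r ρ := lt_max_of_lt_left hr
  have hsq1 : ‖circlePt r θ - circlePt ρ φ‖ ^ 2 = r ^ 2 + ρ ^ 2 - 2 * r * ρ * Real.cos (θ - φ) := by
    rw [EuclideanSpace.norm_sq_eq]
    simp only [Fin.sum_univ_two, PiLp.sub_apply, circlePt_apply_zero, circlePt_apply_one,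
      Real.norm_eq_abs, sq_abs, Real.cos_sub]
    linear_combination r ^ 2 * Real.sin_sq_add_cos_sq θ + ρ ^ 2 * Real.sin_sq_add_cos_sq φ
  have hsq2 : (max r ρ * ‖1 - ((min r ρ / max r ρ : ℝ) : ℂ) *
      Complex.exp (((θ - φ : ℝ) : ℂ) * Complex.I)‖) ^ 2 = r ^ 2 + ρ ^ 2 - 2 * r * ρ * Real.cos (θ - φ) := by
    rw [mul_pow, norm_one_sub_mul_exp_sq]
    rcases le_total r ρ with h | h
    · have hρ0 : ρ ≠ 0 := (lt_of_lt_of_le hr h).ne'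
      rw [max_eq_right h, min_eq_left h]
      field_simp
      ring
    · rw [max_eq_left h, min_eq_right h]
      field_simp
      ring
  exact (sq_eq_sq₀ (norm_nonneg _) (by positivity)).1 (hsq1.trans hsq2.symm)

/-- **The logarithmic kernel on a circle**: for `r > 0` and `|η| ≠ r`,
`log |circlePt r θ − η| = log max(r, |η|) + ℓ_t(θ − arg η)`, `t = min(r,|η|)/max(r,|η|) < 1`,
`ℓ_t = circleLogKernelR t`. [folklore] -/
theorem modeSplit_log_norm_circlePt_sub {r : ℝ} (hr : 0 < r) {η : EuclideanSpace ℝ (Fin 2)} (hη : ‖η‖ ≠ r) (θ : ℝ) :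
    Real.log ‖circlePt r θ - η‖ = Real.log (max r ‖η‖) +
      circleLogKernelR (min r ‖η‖ / max r ‖η‖) (θ - Complex.arg (cplx η)) := by
  have hM : 0 < max r ‖η‖ := lt_max_of_lt_left hr
  have ht0 : 0 ≤ min r ‖η‖ / max r ‖η‖ := div_nonneg (le_min hr.le (norm_nonneg η)) hM.le
  have ht1 : min r ‖η‖ / max r ‖η‖ < 1 := (div_lt_one hM).2 (min_lt_max.2 (Ne.symm hη))
  have hpos : 0 < ‖1 - ((min r ‖η‖ / max r ‖η‖ : ℝ) : ℂ) *
      Complex.exp (((θ - Complex.arg (cplx η) : ℝ) : ℂ) * Complex.I)‖ :=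
    lt_of_lt_of_le (by linarith) (one_sub_le_norm_one_sub_mul_exp ht0 _)
  conv_lhs => rw [← circlePt_norm_arg η]
  rw [modeSplit_norm_circlePt_sub_circlePt hr, Real.log_mul hM.ne' hpos.ne', circleLogKernelR]

/-! ### First Fourier moments of the regularised circle kernel, shifted -/

/-- `∫_{-π}^{π} ℓ_t(β − u) cos β dβ = −π t cos u` (`0 ≤ t < 1`). [folklore] -/
theorem modeSplit_integral_circleLogKernelR_sub_mul_cos {t : ℝ} (ht0 : 0 ≤ t) (ht1 : t < 1) (u : ℝ) :
    ∫ β in (-π)..π, circleLogKernelR t (β - u) * Real.cos β = -π * t * Real.cos u := by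
  have h := integral_circleLogKernelR_sub_mul ht0 ht1 u 0 1
  simp only [zero_add, one_mul, mul_one] at h
  simp_rw [circleLogKernelR_sub_comm t _ u]
  exact h

/-- `∫_{-π}^{π} ℓ_t(β − u) sin β dβ = −π t sin u` (`0 ≤ t < 1`; shift by `u` using periodicity, then
`sin(v + u) = sin v cos u + cos v sin u`, `∫ ℓ_t sin = 0`, `∫ ℓ_t cos = −π t`). [folklore] -/
theorem modeSplit_integral_circleLogKernelR_sub_mul_sin {t : ℝ} (ht0 : 0 ≤ t) (ht1 : t < 1) (u : ℝ) :
    ∫ β in (-π)..π, circleLogKernelR t (β - u) * Real.sin β = -π * t * Real.sin u := by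
  -- adapted from `Literature.Analysis.Potential.integral_circleLogKernelR_sub_mul`
  set H : ℝ → ℝ := fun v => circleLogKernelR t v * Real.sin (v + u) with hH
  have h1 : (∫ β in (-π)..π, circleLogKernelR t (β - u) * Real.sin β) = ∫ β in (-π)..π, H (β - u) := by
    refine intervalIntegral.integral_congr fun β _ => ?_
    simp only [hH, sub_add_cancel]
  have hp : Function.Periodic H (2 * π) := fun v => by
    simp only [hH, periodic_circleLogKernelR t v, add_right_comm v (2 * π) u, Real.sin_add_two_pi]
  rw [h1, intervalIntegral.integral_comp_sub_right H u, show π - u = (-π - u) + 2 * π by ring,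
    hp.intervalIntegral_add_eq (-π - u) (-π), show -π + 2 * π = π by ring]
  have h2 : ∀ v, H v = Real.cos u * (circleLogKernelR t v * Real.sin v) +
      Real.sin u * (circleLogKernelR t v * Real.cos v) := fun v => by
    simp only [hH, Real.sin_add]; ring
  simp_rw [h2]
  have hi1 := intervalIntegrable_circleLogKernelR t (-π) π
  have hi2 : IntervalIntegrable (fun v => circleLogKernelR t v * Real.cos v) volume (-π) π :=
    hi1.mul_continuousOn Real.continuous_cos.continuousOn
  have hi3 : IntervalIntegrable (fun v => circleLogKernelR t v * Real.sin v) volume (-π) π :=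
    hi1.mul_continuousOn Real.continuous_sin.continuousOn
  rw [intervalIntegral.integral_add (hi3.const_mul _) (hi2.const_mul _),
    intervalIntegral.integral_const_mul, intervalIntegral.integral_const_mul,
    integral_circleLogKernelR_mul_sin, integral_circleLogKernelR_mul_cos ht0 ht1]
  ring

/-! ### The `k = ±1` circle moments of the logarithmic kernel -/

/-- `η₀ = |η| cos(arg η)`, `η₁ = |η| sin(arg η)`. [folklore] -/
theorem modeSplit_coord_eq_norm_mul (η : EuclideanSpace ℝ (Fin 2)) :
    η 0 = ‖η‖ * Real.cos (Complex.arg (cplx η)) ∧ η 1 = ‖η‖ * Real.sin (Complex.arg (cplx η)) := by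
  have h := circlePt_norm_arg η
  constructor
  · calc η 0 = circlePt ‖η‖ (Complex.arg (cplx η)) 0 := by rw [h]
      _ = ‖η‖ * Real.cos (Complex.arg (cplx η)) := rfl
  · calc η 1 = circlePt ‖η‖ (Complex.arg (cplx η)) 1 := by rw [h]
      _ = ‖η‖ * Real.sin (Complex.arg (cplx η)) := rfl

/-- **`∫_{-π}^{π} log |circlePt r θ − η| cos θ dθ = −π t(r,|η|) η₀/|η|`** for `r > 0`, `|η| ≠ r`,
`t(r,ρ) = min(r,ρ)/max(r,ρ)`. [folklore] -/
theorem modeSplit_integral_log_circle_cos {r : ℝ} (hr : 0 < r) {η : EuclideanSpace ℝ (Fin 2)} (hη : ‖η‖ ≠ r) :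
    ∫ θ in (-π)..π, Real.log ‖circlePt r θ - η‖ * Real.cos θ =
      -π * (min r ‖η‖ / max r ‖η‖) * (η 0 / ‖η‖) := by
  set t := min r ‖η‖ / max r ‖η‖ with ht
  have hM : 0 < max r ‖η‖ := lt_max_of_lt_left hr
  have ht0 : 0 ≤ t := div_nonneg (le_min hr.le (norm_nonneg η)) hM.le
  have ht1 : t < 1 := (div_lt_one hM).2 (min_lt_max.2 (Ne.symm hη))
  simp_rw [modeSplit_log_norm_circlePt_sub hr hη, add_mul]
  have i1 : IntervalIntegrable (fun θ => Real.log (max r ‖η‖) * Real.cos θ) volume (-π) π :=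
    (continuous_const.mul Real.continuous_cos).intervalIntegrable _ _
  have i2 : IntervalIntegrable (fun θ => circleLogKernelR t (θ - Complex.arg (cplx η)) * Real.cos θ)
      volume (-π) π :=
    (intervalIntegrable_circleLogKernelR_sub t _ _ _).mul_continuousOn Real.continuous_cos.continuousOn
  rw [intervalIntegral.integral_add i1 i2, intervalIntegral.integral_const_mul, modeSplit_integral_cos,
    mul_zero, zero_add, modeSplit_integral_circleLogKernelR_sub_mul_cos ht0 ht1]
  rcases (norm_nonneg η).eq_or_lt with h0 | hpos
  · have : t = 0 := by rw [ht, ← h0, min_eq_right hr.le, zero_div]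
    rw [this]; ring
  · rw [(modeSplit_coord_eq_norm_mul η).1]
    field_simp

/-- **`∫_{-π}^{π} log |circlePt r θ − η| sin θ dθ = −π t(r,|η|) η₁/|η|`** for `r > 0`, `|η| ≠ r`. [folklore] -/
theorem modeSplit_integral_log_circle_sin {r : ℝ} (hr : 0 < r) {η : EuclideanSpace ℝ (Fin 2)} (hη : ‖η‖ ≠ r) :
    ∫ θ in (-π)..π, Real.log ‖circlePt r θ - η‖ * Real.sin θ =
      -π * (min r ‖η‖ / max r ‖η‖) * (η 1 / ‖η‖) := by
  set t := min r ‖η‖ / max r ‖η‖ with ht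
  have hM : 0 < max r ‖η‖ := lt_max_of_lt_left hr
  have ht0 : 0 ≤ t := div_nonneg (le_min hr.le (norm_nonneg η)) hM.le
  have ht1 : t < 1 := (div_lt_one hM).2 (min_lt_max.2 (Ne.symm hη))
  simp_rw [modeSplit_log_norm_circlePt_sub hr hη, add_mul]
  have i1 : IntervalIntegrable (fun θ => Real.log (max r ‖η‖) * Real.sin θ) volume (-π) π :=
    (continuous_const.mul Real.continuous_sin).intervalIntegrable _ _
  have i2 : IntervalIntegrable (fun θ => circleLogKernelR t (θ - Complex.arg (cplx η)) * Real.sin θ)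
      volume (-π) π :=
    (intervalIntegrable_circleLogKernelR_sub t _ _ _).mul_continuousOn Real.continuous_sin.continuousOn
  rw [intervalIntegral.integral_add i1 i2, intervalIntegral.integral_const_mul, modeSplit_integral_sin,
    mul_zero, zero_add, modeSplit_integral_circleLogKernelR_sub_mul_sin ht0 ht1]
  rcases (norm_nonneg η).eq_or_lt with h0 | hpos
  · have : t = 0 := by rw [ht, ← h0, min_eq_right hr.le, zero_div]
    rw [this]; ring
  · rw [(modeSplit_coord_eq_norm_mul η).2]
    field_simp

/-- For `r, s > 0`: `min(r,s)/max(r,s) = min(r/s, s/r)`. [folklore] -/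
theorem modeSplit_min_div_max {r s : ℝ} (hr : 0 < r) (hs : 0 < s) :
    min r s / max r s = min (r / s) (s / r) := by
  rcases le_total r s with h | h
  · rw [min_eq_left h, max_eq_right h, min_eq_left]
    exact ((div_le_one hs).2 h).trans ((one_le_div hr).2 h)
  · rw [min_eq_right h, max_eq_left h, min_eq_right]
    exact ((div_le_one hr).2 h).trans ((one_le_div hs).2 h)

/-! ### The logarithmic kernel against a Gaussian-bounded density: a bound linear in `|x|` -/

/-- **`∫ |log |x − y|| |f(y)| dy ≤ K (1 + |x|)`** for a continuous `f` with `|f| ≤ B e^{−|y|²/8}`, with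
integrability of the integrand (`|log t| ≤ t⁻¹ + t`, the uniform bound on `∫ |f(y)|/|x − y| dy`, and
`|x − y| ≤ |x| + |y|`). [folklore] -/
theorem modeSplit_integral_abs_log_mul_le {f : EuclideanSpace ℝ (Fin 2) → ℝ} (hf : Continuous f) {B : ℝ}
    (hB : ∀ y, |f y| ≤ B * Real.exp (-(1 / 8) * ‖y‖ ^ 2)) :
    ∃ K : ℝ, 0 ≤ K ∧ ∀ x : EuclideanSpace ℝ (Fin 2), Integrable (fun y => |Real.log ‖x - y‖| * |f y|) ∧
      ∫ y, |Real.log ‖x - y‖| * |f y| ≤ K * (1 + ‖x‖) := by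
  have hB0 : 0 ≤ B := (abs_nonneg _).trans ((hB 0).trans (le_of_eq (by simp)))
  have hfi : Integrable f := by
    refine ((integrable_one_add_norm_pow_mul_exp_eighth 0).const_mul B).mono' hf.aestronglyMeasurable
      (Eventually.of_forall fun y => ?_)
    rw [Real.norm_eq_abs, pow_zero, one_mul]; exact hB y
  have hfy : Integrable fun y : EuclideanSpace ℝ (Fin 2) => ‖y‖ * |f y| := by
    refine ((integrable_one_add_norm_pow_mul_exp_eighth 1).const_mul B).mono'
      (continuous_norm.mul (continuous_abs.comp hf)).aestronglyMeasurable (Eventually.of_forall fun y => ?_)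
    rw [Real.norm_of_nonneg (by positivity), pow_one]
    calc ‖y‖ * |f y| ≤ (1 + ‖y‖) * (B * Real.exp (-(1 / 8) * ‖y‖ ^ 2)) :=
          mul_le_mul (by linarith [norm_nonneg y]) (hB y) (abs_nonneg _) (by positivity)
      _ = _ := by ring
  set I : ℝ := ∫ z, indicator (ball (0 : EuclideanSpace ℝ (Fin 2)) 1) (fun z => ‖z‖⁻¹) z with hI
  set F : ℝ := ∫ y, |f y| with hF
  set G : ℝ := ∫ y, ‖y‖ * |f y| with hG
  have hI0 : 0 ≤ I := integral_nonneg indicator_inv_norm_nonneg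
  have hF0 : 0 ≤ F := integral_nonneg fun y => abs_nonneg _
  have hG0 : 0 ≤ G := integral_nonneg fun y => by positivity
  refine ⟨B * I + F + G, by positivity, fun x => ?_⟩
  have hBle : ∀ y, |f y| ≤ B := fun y =>
    (hB y).trans (mul_le_of_le_one_right hB0 (Real.exp_le_one_iff.2 (by nlinarith [norm_nonneg y])))
  obtain ⟨h1, h1le⟩ := integral_mul_inv_norm_sub_le hfi.abs (fun y => abs_nonneg _) hBle x
  have hmeas : AEStronglyMeasurable (fun y => |Real.log ‖x - y‖| * |f y|) volume :=
    (((measurable_const.sub measurable_id).norm.log.abs).mul (hf.measurable.abs)).aestronglyMeasurable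
  have hpt : ∀ y, |Real.log ‖x - y‖| * |f y| ≤
      |f y| * ‖x - y‖⁻¹ + (‖x‖ * |f y| + ‖y‖ * |f y|) := by
    intro y
    have h0 : 0 ≤ |f y| := abs_nonneg _
    rcases (norm_nonneg (x - y)).eq_or_lt with hz | hz
    · rw [← hz, Real.log_zero, abs_zero, zero_mul]; positivity
    · have hl := abs_log_le_inv_add_self hz
      have hxy : ‖x - y‖ ≤ ‖x‖ + ‖y‖ := norm_sub_le x y
      calc |Real.log ‖x - y‖| * |f y| ≤ (‖x - y‖⁻¹ + ‖x - y‖) * |f y| :=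
            mul_le_mul_of_nonneg_right hl h0
        _ ≤ (‖x - y‖⁻¹ + (‖x‖ + ‖y‖)) * |f y| := by gcongr
        _ = _ := by ring
  have hdom : Integrable fun y => |f y| * ‖x - y‖⁻¹ + (‖x‖ * |f y| + ‖y‖ * |f y|) :=
    h1.add ((hfi.abs.const_mul _).add hfy)
  have hint : Integrable fun y => |Real.log ‖x - y‖| * |f y| :=
    hdom.mono' hmeas (Eventually.of_forall fun y => by
      rw [Real.norm_of_nonneg (by positivity)]; exact hpt y)
  refine ⟨hint, ?_⟩
  calc ∫ y, |Real.log ‖x - y‖| * |f y|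
      ≤ ∫ y, |f y| * ‖x - y‖⁻¹ + (‖x‖ * |f y| + ‖y‖ * |f y|) := integral_mono hint hdom hpt
    _ = (∫ y, |f y| * ‖x - y‖⁻¹) + (‖x‖ * F + G) := by
        have hi1 : Integrable fun y => ‖x‖ * |f y| := hfi.abs.const_mul _
        have hi2 : Integrable fun y => ‖x‖ * |f y| + ‖y‖ * |f y| := hi1.add hfy
        rw [integral_add h1 hi2, integral_add hi1 hfy, integral_const_mul]
    _ ≤ (B * I + F) + (‖x‖ * F + G) := by gcongr
    _ ≤ (B * I + F + G) * (1 + ‖x‖) := by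
        nlinarith [norm_nonneg x, mul_nonneg (norm_nonneg x) (add_nonneg (mul_nonneg hB0 hI0) hG0)]

/-! ### Fubini on `(−π, π] × ℝ²` for circle integrals of the potential -/

/-- **Integrability on `(−π, π] × ℝ²`** of `(θ, y) ↦ w(θ) N(circlePt r θ − y) f(y)`, `N = (2π)⁻¹ log |·|`,
for a continuous Gaussian-bounded `f` and a continuous weight `|w| ≤ 1` (the `y`-integrals of the
absolute value are bounded uniformly on the circle). [folklore] -/
theorem modeSplit_integrable_circle_logKernel {f : EuclideanSpace ℝ (Fin 2) → ℝ} (hf : Continuous f) {B : ℝ}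
    (hB : ∀ y, |f y| ≤ B * Real.exp (-(1 / 8) * ‖y‖ ^ 2)) (r : ℝ) {w : ℝ → ℝ} (hw : Continuous w)
    (hw1 : ∀ θ, |w θ| ≤ 1) :
    Integrable (uncurry fun (θ : ℝ) (y : EuclideanSpace ℝ (Fin 2)) =>
        w θ * ((2 * Real.pi)⁻¹ * Real.log ‖circlePt r θ - y‖ * f y))
      ((volume.restrict (Ioc (-π) π)).prod volume) := by
  obtain ⟨K, hK0, hK⟩ := modeSplit_integral_abs_log_mul_le hf hB
  have hmeas : Measurable (uncurry fun (θ : ℝ) (y : EuclideanSpace ℝ (Fin 2)) =>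
      w θ * ((2 * Real.pi)⁻¹ * Real.log ‖circlePt r θ - y‖ * f y)) :=
    (hw.measurable.comp measurable_fst).mul
      ((measurable_const.mul ((((continuous_circlePt r).measurable.comp measurable_fst).sub
        measurable_snd).norm.log)).mul (hf.measurable.comp measurable_snd))
  have hpt : ∀ (θ : ℝ) (y : EuclideanSpace ℝ (Fin 2)), ‖w θ * ((2 * Real.pi)⁻¹ * Real.log ‖circlePt r θ - y‖ * f y)‖ ≤
      (2 * π)⁻¹ * (|Real.log ‖circlePt r θ - y‖| * |f y|) := by
    intro θ y
    rw [Real.norm_eq_abs, abs_mul, abs_mul, abs_mul, abs_of_pos (by positivity : (0 : ℝ) < (2 * π)⁻¹)]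
    calc |w θ| * ((2 * π)⁻¹ * |Real.log ‖circlePt r θ - y‖| * |f y|)
        ≤ 1 * ((2 * π)⁻¹ * |Real.log ‖circlePt r θ - y‖| * |f y|) := by gcongr; exact hw1 θ
      _ = _ := by ring
  rw [integrable_prod_iff hmeas.aestronglyMeasurable]
  constructor
  · refine Eventually.of_forall fun θ => ?_
    exact ((hK (circlePt r θ)).1.const_mul ((2 * π)⁻¹)).mono'
      (hmeas.comp measurable_prodMk_left).aestronglyMeasurable (Eventually.of_forall fun y => hpt θ y)
  · refine (integrable_const ((2 * π)⁻¹ * (K * (1 + |r|)))).mono'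
      hmeas.aestronglyMeasurable.norm.integral_prod_right' (Eventually.of_forall fun θ => ?_)
    rw [Real.norm_of_nonneg (integral_nonneg fun y => norm_nonneg _)]
    calc ∫ y, ‖uncurry (fun (θ : ℝ) (y : EuclideanSpace ℝ (Fin 2)) =>
            w θ * ((2 * Real.pi)⁻¹ * Real.log ‖circlePt r θ - y‖ * f y)) (θ, y)‖
        ≤ ∫ y, (2 * π)⁻¹ * (|Real.log ‖circlePt r θ - y‖| * |f y|) :=
          integral_mono_of_nonneg (Eventually.of_forall fun y => norm_nonneg _)
            ((hK _).1.const_mul _) (Eventually.of_forall fun y => hpt θ y)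
      _ = (2 * π)⁻¹ * ∫ y, |Real.log ‖circlePt r θ - y‖| * |f y| := integral_const_mul _ _
      _ ≤ (2 * π)⁻¹ * (K * (1 + ‖circlePt r θ‖)) := by gcongr; exact (hK _).2
      _ = (2 * π)⁻¹ * (K * (1 + |r|)) := by rw [norm_circlePt]

/-! ### The registered tools stub -/

/-- **Registered tools stub `stub_arnoldModeSplitToolsC`** (helpers for `stub_arnoldModeSplit`, line `Sketch`
of crux `CoreLinearInvertibility`, stmt-NavierStokesRegularity-17973): the `k = ±1` circle moments of the
logarithmic kernel, the linear bound `∫ |log|x − y|| |f(y)| dy ≤ K(1 + |x|)` for Gaussian-bounded `f`, and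
the integrability of `(θ, y) ↦ w(θ) N(circlePt r θ − y) f(y)` on `(−π, π] × ℝ²`. [folklore] -/
theorem stub_arnoldModeSplitToolsC :
    (∀ (r : ℝ) (η : EuclideanSpace ℝ (Fin 2)), 0 < r → ‖η‖ ≠ r →
      ∫ θ in (-Real.pi)..Real.pi, Real.log ‖circlePt r θ - η‖ * Real.cos θ =
        -Real.pi * (min r ‖η‖ / max r ‖η‖) * (η 0 / ‖η‖) ∧
      ∫ θ in (-Real.pi)..Real.pi, Real.log ‖circlePt r θ - η‖ * Real.sin θ =
        -Real.pi * (min r ‖η‖ / max r ‖η‖) * (η 1 / ‖η‖)) ∧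
    (∀ f : EuclideanSpace ℝ (Fin 2) → ℝ, Continuous f → ∀ B : ℝ,
      (∀ y, |f y| ≤ B * Real.exp (-(1 / 8) * ‖y‖ ^ 2)) →
      (∃ K : ℝ, 0 ≤ K ∧ ∀ x : EuclideanSpace ℝ (Fin 2), Integrable (fun y => |Real.log ‖x - y‖| * |f y|) ∧
        ∫ y, |Real.log ‖x - y‖| * |f y| ≤ K * (1 + ‖x‖)) ∧
      ∀ (r : ℝ) (w : ℝ → ℝ), Continuous w → (∀ θ, |w θ| ≤ 1) →
        Integrable (Function.uncurry fun (θ : ℝ) (y : EuclideanSpace ℝ (Fin 2)) =>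
          w θ * ((2 * Real.pi)⁻¹ * Real.log ‖circlePt r θ - y‖ * f y))
          ((volume.restrict (Set.Ioc (-Real.pi) Real.pi)).prod volume)) :=
  ⟨fun _ _ hr hη => ⟨modeSplit_integral_log_circle_cos hr hη, modeSplit_integral_log_circle_sin hr hη⟩,
    fun _ hf _ hB => ⟨modeSplit_integral_abs_log_mul_le hf hB, fun r _ hw hw1 =>
      modeSplit_integrable_circle_logKernel hf hB r hw hw1⟩⟩

end Summit.NavierStokesRegularity.NavierStokesRegularity.Theorems
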